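import Mathlib
import Literature.Analysis.FluidPDE.Tao2016AveragedNS.ShiftSetCascadeFlows
import Literature.Analysis.FluidPDE.Tao2016AveragedNS.ShiftSetCascadeFlux
import Literature.Analysis.FluidPDE.Tao2016AveragedNS.WeightedLatticeFlowsOn
import Summits.NavierStokesRegularity.NavierStokesRegularity.Theorems.TaoLadderRungTwoFlatCertificateGlueGapDataOn
import Summits.NavierStokesRegularity.NavierStokesRegularity.Theorems.TaoLadderRungTwoFlatCertificateBlowupOn
import HarnessLib

/-!
# Certificate glue on a shift set `𝕊`, V: A WINDOW CERTIFICATE GIVES BLOW-UP, and admissibility of the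
  Banach-space weight on a nearest-neighbour shift set (helper for item stmt-NavierStokesRegularity-22987
  `FlatGapCertificatesV2`, crux K_A♭ of route TaoLadderRungTwoFlat; cell harvest/h2-tao-ladder, p1 g13)

* `weightRatiosLEOn_of_nearestNeighbour` — on a nearest-neighbour shift set (`𝕊 ⊆ {0,1}³`) the admissibility
  condition `WeightRatiosLEOn 𝕊 ε₀ ω A` of the existence theory (`Literature…WeightedLatticeFlowsOn`) follows
  from THREE scalar families: the same-shell ratio `(1+ε₀)^{5k/2}/ω_k ≤ A₁`, the backward ratio
  `ω_k/ω_{k+1} ≤ A₂` and the pump ratio `(1+ε₀)^{5(k-1)/2} ω_k/ω_{k-1}² ≤ A₃` (the eight classes of `{0,1}³`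
  are products of these), with `A = A₁ + A₁A₂ + A₁A₂² + A₃`.
* `noGlobalCascadeOn_of_windowCertificate` — THE END-TO-END STATEMENT: a C⁰ window certificate for the
  exact `𝕊`-lattice of a table `α ∈ E(𝕊, R)` at scale ratio `1+ε₀` (glue IV's hypotheses) and a charged datum
  `X₀ i₀ ≠ 0` give `NoGlobalCascadeOn 𝕊 ε₀ α X₀` — Theorem-4.2-level blow-up of that table at that scale
  ratio (glue IV `gapData₂On_of_windowCertificate` ∘ `noGlobalCascadeOn_of_gapData₂On` = K_B on `𝕊` +
  restart supports, all PROVED in the tree).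

HONEST FRAMING: Tao-type MODEL lattices on a general nearest-neighbour slot-closed shift set `𝕊 ∌ (1,1,1)`
(e.g. `S`, `S♭`); the window certificate is a HYPOTHESIS — nothing is certified here; nothing is a
statement about the Navier–Stokes equations.
-/

noncomputable section

-- the sub-problem namespace repeats the summit name by design (D-0017)
set_option linter.dupNamespace false

namespace Summit.NavierStokesRegularity.NavierStokesRegularity.Theorems

open Set Filter Topology MeasureTheory intervalIntegral Literature.Analysis.FluidPDE
  Literature.Analysis.FluidPDE.TaoCascade
open Summit.NavierStokesRegularity.NavierStokesRegularity.Theorems.GappedFrontRobustOn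

namespace CertificateGlueOn

variable {m : ℕ} {𝕊 : Finset (ℤ × ℤ × ℤ)}

/-- **Admissible weights on a nearest-neighbour shift set from three scalar families.** If `𝕊 ⊆ {0,1}³`,
`ω > 0`, `(1+ε₀)^{5k/2}/ω_k ≤ A₁`, `ω_k/ω_{k+1} ≤ A₂` and `(1+ε₀)^{5(k-1)/2} ω_k/ω_{k-1}² ≤ A₃` for all `k`
(`A₁, A₂, A₃ ≥ 0`), then `WeightRatiosLEOn 𝕊 ε₀ ω (A₁ + A₁A₂ + A₁A₂² + A₃)`.
[cite: Tao2016AveragedNS, §4 (4.8) (the gains) and after (4.1) (the shift set); cell vocabulary, shift-set parametrised] -/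
theorem weightRatiosLEOn_of_nearestNeighbour (h𝕊 : IsNearestNeighbourSet 𝕊) {ε₀ A₁ A₂ A₃ : ℝ}
    {ω : ℤ → ℝ} (hε : 0 < 1 + ε₀) (hω : ∀ k, 0 < ω k) (hA₁ : 0 ≤ A₁) (hA₂ : 0 ≤ A₂) (hA₃ : 0 ≤ A₃)
    (h1 : ∀ k : ℤ, (1 + ε₀) ^ ((5 : ℝ) * k / 2) / ω k ≤ A₁)
    (h2 : ∀ k : ℤ, ω k / ω (k + 1) ≤ A₂)
    (h3 : ∀ k : ℤ, (1 + ε₀) ^ ((5 : ℝ) * ((k : ℝ) - 1) / 2) * ω k / ω (k - 1) ^ 2 ≤ A₃) :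
    WeightRatiosLEOn 𝕊 ε₀ ω (A₁ + A₁ * A₂ + A₁ * A₂ ^ 2 + A₃) := by
  refine ⟨hω, fun k μ hμ => ?_⟩
  obtain ⟨hμ1, hμ2, hμ3⟩ := h𝕊 μ hμ
  set A : ℝ := A₁ + A₁ * A₂ + A₁ * A₂ ^ 2 + A₃ with hA
  have hA1A : A₁ ≤ A := by rw [hA]; nlinarith [mul_nonneg hA₁ hA₂, mul_nonneg hA₁ (sq_nonneg A₂)]
  have hA12A : A₁ * A₂ ≤ A := by rw [hA]; nlinarith [mul_nonneg hA₁ (sq_nonneg A₂)]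
  have hA122A : A₁ * A₂ ^ 2 ≤ A := by rw [hA]; nlinarith [mul_nonneg hA₁ hA₂]
  have hA3A : A₃ ≤ A := by rw [hA]; nlinarith [mul_nonneg hA₁ hA₂, mul_nonneg hA₁ (sq_nonneg A₂)]
  -- the ratios we combine
  have hL : ∀ k : ℤ, 0 < (1 + ε₀) ^ ((5 : ℝ) * k / 2) := fun k => Real.rpow_pos_of_pos hε _
  have hback : ∀ k : ℤ, (1 + ε₀) ^ ((5 : ℝ) * k / 2) / ω (k + 1) ≤ A₁ * A₂ := by
    intro k
    have e : (1 + ε₀) ^ ((5 : ℝ) * k / 2) / ω (k + 1) =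
        ((1 + ε₀) ^ ((5 : ℝ) * k / 2) / ω k) * (ω k / ω (k + 1)) := by
      have := (hω k).ne'; field_simp
    rw [e]
    exact mul_le_mul (h1 k) (h2 k) (div_nonneg (hω k).le (hω (k + 1)).le) hA₁
  have hback2 : ∀ k : ℤ, (1 + ε₀) ^ ((5 : ℝ) * k / 2) * ω k / ω (k + 1) ^ 2 ≤ A₁ * A₂ ^ 2 := by
    intro k
    have e : (1 + ε₀) ^ ((5 : ℝ) * k / 2) * ω k / ω (k + 1) ^ 2 =
        ((1 + ε₀) ^ ((5 : ℝ) * k / 2) / ω k) * (ω k / ω (k + 1)) ^ 2 := by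
      have := (hω k).ne'; have := (hω (k + 1)).ne'; field_simp
    rw [e]
    have hsq : (ω k / ω (k + 1)) ^ 2 ≤ A₂ ^ 2 :=
      pow_le_pow_left₀ (div_nonneg (hω k).le (hω (k + 1)).le) (h2 k) 2
    exact mul_le_mul (h1 k) hsq (sq_nonneg _) hA₁
  -- exponent at the base shell `k - μ₃`
  rcases hμ3 with h30 | h31
  · -- μ₃ = 0 : base shell k
    have hexp : (1 + ε₀) ^ ((5 : ℝ) * (k - μ.2.2) / 2) = (1 + ε₀) ^ ((5 : ℝ) * k / 2) := by
      rw [h30]; push_cast; ring_nf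
    rw [hexp]
    simp only [h30, sub_zero]
    rcases hμ1 with h10 | h11 <;> rcases hμ2 with h20 | h21
    · -- (0,0,0)
      rw [h10, h20, add_zero]
      calc (1 + ε₀) ^ ((5 : ℝ) * k / 2) * ω k / (ω k * ω k)
          = (1 + ε₀) ^ ((5 : ℝ) * k / 2) / ω k := by have := (hω k).ne'; field_simp
        _ ≤ A₁ := h1 k
        _ ≤ A := hA1A
    · -- (0,1,0)
      rw [h10, h21, add_zero]
      calc (1 + ε₀) ^ ((5 : ℝ) * k / 2) * ω k / (ω k * ω (k + 1))
          = (1 + ε₀) ^ ((5 : ℝ) * k / 2) / ω (k + 1) := by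
            have := (hω k).ne'; have := (hω (k + 1)).ne'; field_simp
        _ ≤ A₁ * A₂ := hback k
        _ ≤ A := hA12A
    · -- (1,0,0)
      rw [h11, h20, add_zero]
      calc (1 + ε₀) ^ ((5 : ℝ) * k / 2) * ω k / (ω (k + 1) * ω k)
          = (1 + ε₀) ^ ((5 : ℝ) * k / 2) / ω (k + 1) := by
            have := (hω k).ne'; have := (hω (k + 1)).ne'; field_simp
        _ ≤ A₁ * A₂ := hback k
        _ ≤ A := hA12A
    · -- (1,1,0)
      rw [h11, h21]
      calc (1 + ε₀) ^ ((5 : ℝ) * k / 2) * ω k / (ω (k + 1) * ω (k + 1))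
          = (1 + ε₀) ^ ((5 : ℝ) * k / 2) * ω k / ω (k + 1) ^ 2 := by ring
        _ ≤ A₁ * A₂ ^ 2 := hback2 k
        _ ≤ A := hA122A
  · -- μ₃ = 1 : base shell k - 1
    have hexp : (1 + ε₀) ^ ((5 : ℝ) * (k - μ.2.2) / 2) = (1 + ε₀) ^ ((5 : ℝ) * ((k : ℝ) - 1) / 2) := by
      rw [h31]; push_cast; ring_nf
    rw [hexp]
    simp only [h31]
    have hk1 : (1 + ε₀) ^ ((5 : ℝ) * ((k : ℝ) - 1) / 2) = (1 + ε₀) ^ ((5 : ℝ) * ((k - 1 : ℤ) : ℝ) / 2) := by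
      push_cast; ring_nf
    rcases hμ1 with h10 | h11 <;> rcases hμ2 with h20 | h21
    · -- (0,0,1)
      rw [h10, h20, add_zero]
      calc (1 + ε₀) ^ ((5 : ℝ) * ((k : ℝ) - 1) / 2) * ω k / (ω (k - 1) * ω (k - 1))
          = (1 + ε₀) ^ ((5 : ℝ) * ((k : ℝ) - 1) / 2) * ω k / ω (k - 1) ^ 2 := by ring
        _ ≤ A₃ := h3 k
        _ ≤ A := hA3A
    · -- (0,1,1)
      rw [h10, h21, add_zero, sub_add_cancel]
      calc (1 + ε₀) ^ ((5 : ℝ) * ((k : ℝ) - 1) / 2) * ω k / (ω (k - 1) * ω k)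
          = (1 + ε₀) ^ ((5 : ℝ) * ((k - 1 : ℤ) : ℝ) / 2) / ω (k - 1) := by
            rw [hk1]; have := (hω k).ne'; have := (hω (k - 1)).ne'; field_simp
        _ ≤ A₁ := h1 (k - 1)
        _ ≤ A := hA1A
    · -- (1,0,1)
      rw [h11, h20, add_zero, sub_add_cancel]
      calc (1 + ε₀) ^ ((5 : ℝ) * ((k : ℝ) - 1) / 2) * ω k / (ω k * ω (k - 1))
          = (1 + ε₀) ^ ((5 : ℝ) * ((k - 1 : ℤ) : ℝ) / 2) / ω (k - 1) := by
            rw [hk1]; have := (hω k).ne'; have := (hω (k - 1)).ne'; field_simp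
        _ ≤ A₁ := h1 (k - 1)
        _ ≤ A := hA1A
    · -- (1,1,1)
      rw [h11, h21, sub_add_cancel]
      calc (1 + ε₀) ^ ((5 : ℝ) * ((k : ℝ) - 1) / 2) * ω k / (ω k * ω k)
          = ((1 + ε₀) ^ ((5 : ℝ) * ((k - 1 : ℤ) : ℝ) / 2) / ω (k - 1)) * (ω (k - 1) / ω (k - 1 + 1)) := by
            rw [hk1, sub_add_cancel]; have := (hω k).ne'; have := (hω (k - 1)).ne'; field_simp
        _ ≤ A₁ * A₂ := mul_le_mul (h1 (k - 1)) (h2 (k - 1))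
            (div_nonneg (hω (k - 1)).le (hω (k - 1 + 1)).le) hA₁
        _ ≤ A := hA12A

/-- **A WINDOW CERTIFICATE GIVES BLOW-UP** (end-to-end; see the module docstring and glue IV for the reading
of the hypotheses): under the window-certificate hypotheses of `gapData₂On_of_windowCertificate` for a table
`α ∈ E(𝕊, R)` at scale ratio `1+ε₀` and a charged one-shell datum (`X₀ i₀ ≠ 0`),
`NoGlobalCascadeOn 𝕊 ε₀ α X₀`. [cite: Tao2016AveragedNS, §6.1 p. 31 and §6.2 p. 32 (Thm. 4.2 ⇐ Thm. 6.2 ⇐ Props. 6.3–6.5), for a general table] -/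
theorem noGlobalCascadeOn_of_windowCertificate (h𝕊 : IsNearestNeighbourSet 𝕊) (h𝕊c : IsSlotClosed 𝕊)
    (h111 : ((1 : ℤ), (1 : ℤ), (1 : ℤ)) ∉ 𝕊) {ε₀ R : ℝ} (hε : 0 < ε₀)
    {α : Fin m → Fin m → Fin m → ℤ × ℤ × ℤ → ℝ} (hα : InTableClassOn 𝕊 R α)
    {Cα : ℝ} (hCα0 : 0 ≤ Cα) (hCα : ∀ i, ∑ i₁, ∑ i₂, ∑ μ ∈ 𝕊, |α i₁ i₂ i μ| ≤ Cα)
    {i₀ : Fin m} {X₀ : Fin m → ℝ} (hX₀ : X₀ i₀ ≠ 0)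
    -- window, weights, radius, contraction, exponents, clocks, slack
    {Kb Ka : ℤ} (hKb : 0 ≤ Kb) (hKa : 1 ≤ Ka) {Core : (Fin m → ℤ → ℝ) → Prop} {M w : ℤ → ℝ}
    {r ρ θ₀ θ c₀ c σ : ℝ} (hr : 0 < r) (hρ : 0 ≤ ρ) (hρ1 : ρ < 1) (hθ₀ : 0 ≤ θ₀) (hθ₀θ : θ₀ < θ)
    (hθ : θ ≤ 1 / 2) (hc₀ : 0 < c₀) (hc₀c : c₀ < c) (hσ : 0 < σ) (hw1 : ∀ k, 1 ≤ w k)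
    {Mmax : ℝ} (hMmax : ∀ k, -Kb ≤ k → k ≤ Ka → M k ≤ Mmax)
    (hcore : ∀ z z' : Fin m → ℤ → ℝ, (∀ i k, -Kb ≤ k → k ≤ Ka → z i k = z' i k) → Core z → Core z')
    (hdatum : Core (datumState i₀ X₀))
    -- wake side
    {Zb Zf : ℤ → ℝ} {Zmin Dmax Ct : ℝ} (hZf : ∀ j, j ≤ -Kb → 0 < Zf j) (hZmin : 0 < Zmin)
    (hZmin' : ∀ j, j < -Kb → Zmin ≤ Zf j) (hZb0 : ∀ j, j < -Kb → 0 ≤ Zb j)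
    (hZbf : ∀ j, j < -Kb → Zb j + r / w j ≤ Zf j / 2) (hMZf : M (-Kb) ≤ Zf (-Kb))
    (hcloseB : ∀ j, j < -Kb →
      c * (8 * Cα * (1 + ε₀) ^ ((5 : ℝ) * j / 2) *
        max (Zf (j - 1)) (max (Zf j) (Zf (j + 1))) * max (Zf (j - 1)) (max (Zf j) (Zf (j + 1))) + 0) ≤
        Zf j / 2)
    (hDmax : ∀ j, j < -Kb →
      c * (8 * Cα * (1 + ε₀) ^ ((5 : ℝ) * j / 2) *
        max (Zf (j - 1)) (max (Zf j) (Zf (j + 1))) * max (Zf (j - 1)) (max (Zf j) (Zf (j + 1)))) ≤ Dmax)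
    (hshiftB : ∀ j, j < -Kb →
      (1 + ε₀) ^ θ₀ * (Zb j + r / w j + c * (8 * Cα * (1 + ε₀) ^ ((5 : ℝ) * j / 2) *
        max (Zf (j - 1)) (max (Zf j) (Zf (j + 1))) * max (Zf (j - 1)) (max (Zf j) (Zf (j + 1))))) ≤
        Zb (j - 1))
    (hCt : 0 ≤ Ct) (hZbt : ∀ j, j < -Kb → Zb j ≤ Ct * (1 + ε₀) ^ (-(j : ℝ)))
    (hwt : ∀ k : ℤ, k ≤ 0 → w k ≤ Ct * (1 + ε₀) ^ (-(k : ℝ)))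
    -- quiet side
    {ν : ℤ → ℝ} {ϑ νmax : ℝ}
    (hT1 : ∀ k : ℤ, Ka ≤ k → 2 * (1 + ε₀) ^ (k : ℝ) * w k ≤ w (k + 1))
    (hcoreTop : ∀ z, Core z → ∀ i, 4 * (w Ka * |z i Ka|) ≤ r)
    (hthin : ∀ K : ℤ, Ka + 1 ≤ K →
      (1 + ε₀) ^ ((5 : ℝ) * K / 2) * r * w (K - 1) ≤ ϑ * w (K - 2) ^ 2)
    (hthinW : TailThin ε₀ w r)
    (hν : ∀ K : ℤ, Ka ≤ K → 0 ≤ ν K) (hνmax : ∀ K : ℤ, Ka ≤ K → ν K ≤ νmax)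
    (hcloseA : ∀ K : ℤ, Ka + 1 ≤ K →
      2 * (Real.sqrt 2 * Real.sqrt (4 / 3 * m * (25 / 32 + 0 * (1 + ε₀) ^ ((2 : ℝ) * K))) /
          (2 * (1 + ε₀) ^ ((K - 1 : ℤ) : ℝ)) +
        coeffAbsOn (botShifts 𝕊) α * c * (ϑ / (1 + ε₀) ^ ((5 : ℝ) / 2)) * ν (K - 1) ^ 2) ≤ ν K)
    (hslowA : ∀ K : ℤ, Ka + 1 ≤ K →
      (1 + ε₀) ^ ((5 : ℝ) * (K - 1 : ℤ) / 2) * coeffAbsOn (botShifts 𝕊) α * c *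
        (ν (K - 1) * r / w (K - 2)) ≤ 1 / 2)
    (hMν : M Ka ≤ ν Ka * r / w (Ka - 1))
    (hshiftA : ∀ k : ℤ, Ka < k → ν (k + 1) * (1 + ε₀) ^ θ₀ ≤ ρ)
    -- the certificate's interior, trapping and landing clauses
    (hinside : ∀ (z S₀ : Fin m → ℤ → ℝ), Core z →
      (∀ i k, -Kb ≤ k → k ≤ Ka → w k * |S₀ i k - z i k| ≤ r) → ∀ i k, -Kb ≤ k → k ≤ Ka → |S₀ i k| < M k)
    (htrap : ∀ (s : ℝ) (z : Fin m → ℤ → ℝ) (S : Fin m → ℤ → ℝ → ℝ), Core z → 0 < s → s ≤ c →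
      (∀ i k, -Kb ≤ k → k ≤ Ka → w k * |S i k 0 - z i k| ≤ r) →
      (∀ i k, -Kb ≤ k → k ≤ Ka → ∀ u ∈ Icc 0 s,
        HasDerivWithinAt (S i k) (quadTermOn 𝕊 ε₀ α S i k u) (Icc 0 s) u) →
      (∀ i, ContinuousOn (S i (-Kb - 1)) (Icc 0 s)) → (∀ i, ContinuousOn (S i (Ka + 1)) (Icc 0 s)) →
      (∀ i, ∀ u ∈ Icc 0 s, |S i (-Kb - 1) u| ≤ Zf (-Kb - 1)) →
      (∀ i, ∀ u ∈ Icc 0 s, |S i (Ka + 1) u| ≤ ν (Ka + 1) * r / w Ka) →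
      (∀ i k, -Kb ≤ k → k ≤ Ka → ∀ u ∈ Icc 0 s, |S i k u| ≤ M k) →
        ∀ i k, -Kb ≤ k → k ≤ Ka → ∀ u ∈ Icc 0 s, |S i k u| < M k)
    (hland : ∀ (z : Fin m → ℤ → ℝ) (S : Fin m → ℤ → ℝ → ℝ), Core z →
      (∀ i k, -Kb ≤ k → k ≤ Ka → w k * |S i k 0 - z i k| ≤ r) →
      (∀ i k, -Kb ≤ k → k ≤ Ka → ∀ u ∈ Icc 0 c₀,
        HasDerivWithinAt (S i k) (quadTermOn 𝕊 ε₀ α S i k u) (Icc 0 c₀) u) →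
      (∀ i, ContinuousOn (S i (-Kb - 1)) (Icc 0 c₀)) → (∀ i, ContinuousOn (S i (Ka + 1)) (Icc 0 c₀)) →
      (∀ i, ∀ u ∈ Icc 0 c₀, |S i (-Kb - 1) u| ≤ Zf (-Kb - 1)) →
      (∀ i, ∀ u ∈ Icc 0 c₀, |S i (Ka + 1) u| ≤ ν (Ka + 1) * r / w Ka) →
      (∀ i k, -Kb ≤ k → k ≤ Ka → ∀ u ∈ Icc 0 c₀, |S i k u| ≤ M k) →
        ∃ (τ₁ a : ℝ) (z' : Fin m → ℤ → ℝ), 0 < τ₁ ∧ τ₁ ≤ c₀ ∧ 0 < a ∧ (1 + ε₀) ^ (-θ₀) ≤ a ∧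
          (1 + σ) * a ≤ |S i₀ 1 τ₁| ∧ Core z' ∧
          (∀ i k, -Kb ≤ k → k + 1 ≤ Ka → w k * |S i (1 + k) τ₁ / a - z' i k| ≤ ρ * r) ∧
          (∀ (i : Fin m) (v : ℝ), |v| ≤ ν (Ka + 1) * r / w Ka → w Ka * |v / a - z' i Ka| ≤ ρ * r) ∧
          (∀ i, |S i (-Kb) τ₁| ≤ a * Zb (-Kb - 1)))
    -- the Banach-space weight of the existence theory
    {ω : ℤ → ℝ} {A D Ω : ℝ} (hω : WeightRatiosLEOn 𝕊 ε₀ ω A) (hA : 0 ≤ A)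
    (hD : ∀ k : ℤ, (1 + (1 + ε₀) ^ ((10 : ℝ) * k)) / ω k ≤ D) (hΩ : 0 ≤ Ω)
    (hωlow : ∀ k, k ≤ Ka → ω k ≤ Ω) (hωhigh : ∀ k, Ka < k → ω k ≤ Ω * w (k - 1)) :
    NoGlobalCascadeOn 𝕊 ε₀ α X₀ := by
  obtain ⟨hgap, hthin'⟩ := gapData₂On_of_windowCertificate h𝕊 h𝕊c h111 hε hα hCα0 hCα (i₀ := i₀)
    (X₀ := X₀) hKb hKa hr hρ hρ1 hθ₀ hθ₀θ hθ hc₀ hc₀c hσ hw1 hMmax hcore hdatum hZf hZmin hZmin' hZb0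
    hZbf hMZf hcloseB hDmax hshiftB hCt hZbt hwt hT1 hcoreTop hthin hthinW hν hνmax hcloseA hslowA hMν
    hshiftA hinside htrap hland hω hA hD hΩ hωlow hωhigh
  exact noGlobalCascadeOn_of_gapData₂On h𝕊 h𝕊c h111 hα hε hX₀ hgap hthin'

end CertificateGlueOn

end Summit.NavierStokesRegularity.NavierStokesRegularity.Theorems

end
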